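import Mathlib
import HarnessLib
import Literature.MathematicalPhysics.QuantumLattice.KohnLuttinger
import Summits.HubbardSuperconductivity.HubbardSuperconductivity.Theorems.ChiralWindowCwKLChiralWindowD4Invariant
import Summits.HubbardSuperconductivity.HubbardSuperconductivity.Theorems.ChiralWindowCwKLChiralWindowGradient
import Summits.HubbardSuperconductivity.HubbardSuperconductivity.Theorems.CwKLChiralWindow.Negative.ChannelStructure

/-!
# `stub_klSectorProj`: the isotypic projections of `D₄` on `L²(σ_μ)`

For `μ ∈ (-4, 0)` let `σ_μ = fermiCurveMeasure ε₀ μ` (`ε₀ = squareDispersion 1 0`) and let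
`U : D₄ → (L²(σ_μ) →L L²(σ_μ))` be an abstract family of composition operators:
`U g φ = φ ∘ g` a.e., `U 1 = 1`, `U g U h = U (h g)` (anti-multiplicative: `D₄` acts on the left on
momenta and `U` acts by pre-composition) and `⟨U g φ, ψ⟩ = ⟨φ, U g⁻¹ ψ⟩`.  For every irrep `χ` the
operator `P_χ = (dim χ / 8) ∑_g χ(g) U g` acts a.e. as the pointwise projector `d4Project χ`, is an
idempotent, self-adjoint, commutes with every `U g`, fixes the classes of channel-`χ` functions, every
fixed point has a channel-`χ` representative, and `P_E = (1 - U_{r²}) / 2`.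

The core is finite group algebra for the explicit (real) character table of `D₄`:
* `kl_sp_char_conv`  — `∑_g χ(g) χ(p g⁻¹) = (8 / dim χ) χ(p)` (convolution idempotent),
* `kl_sp_char_inv`   — `χ(g⁻¹) = χ(g)`,
* `kl_sp_char_comm`  — `χ(x y) = χ(y x)`,
all checked on the 8 (resp. 64) group elements, and two abstract consequences in any `ℝ`-algebra
carrying an anti-multiplicative family `V` (`kl_sp_proj_mul_proj`, `kl_sp_comm_proj`), instantiated
once with `V = U` (operators on `L²`) and once with `V g = (· ∘ d4Momentum g)` (endomorphisms of
`Momentum → ℝ`, giving the POINTWISE idempotency of `d4Project`; this uses the action law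
`d4Momentum g ∘ d4Momentum h = d4Momentum (g h)`, `kl_sp_d4_mul`, checked on the 64 pairs).
-/

noncomputable section

set_option linter.dupNamespace false

namespace Summit.HubbardSuperconductivity.HubbardSuperconductivity.Theorems

open MeasureTheory Literature.MathematicalPhysics.QuantumLattice
open Summit.HubbardSuperconductivity.HubbardSuperconductivity.Theorems.CwKLChiralWindow.Negative

/-! ### Finite bookkeeping on `D₄ = DihedralGroup 4` -/

/-- Every element of `D₄` is one of `r 0, …, r 3, sr 0, …, sr 3`. [folklore] -/
theorem kl_sp_d4_cases (p : DihedralGroup 4) :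
    p = .r 0 ∨ p = .r 1 ∨ p = .r 2 ∨ p = .r 3 ∨ p = .sr 0 ∨ p = .sr 1 ∨ p = .sr 2 ∨ p = .sr 3 := by
  revert p
  decide

/-- A sum over `D₄` unfolded over its eight elements, in any additive commutative monoid. [folklore] -/
theorem kl_sp_sum_d4 {M : Type*} [AddCommMonoid M] (f : DihedralGroup 4 → M) :
    ∑ γ, f γ = (f (.r 0) + f (.r 1) + f (.r 2) + f (.r 3)) +
      (f (.sr 0) + f (.sr 1) + f (.sr 2) + f (.sr 3)) := by
  rw [Fintype.sum_equiv DihedralGroup.equivSum f (fun x => f (DihedralGroup.equivSum.symm x))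
    (by intro a; rcases a with j | j <;> rfl)]
  rw [Fintype.sum_sum_type]
  simp only [DihedralGroup.equivSum_symm_apply]
  have h4 : ∀ g : ZMod 4 → M, ∑ i, g i = g 0 + g 1 + g 2 + g 3 := fun g => Fin.sum_univ_four g
  rw [h4, h4]

/-- The characters of `D₄` are real class functions invariant under inversion: `χ(g⁻¹) = χ(g)`
(every element of `D₄` is conjugate to its inverse). [folklore] -/
theorem kl_sp_char_inv (χ : D4Irrep) (g : DihedralGroup 4) : χ.char g⁻¹ = χ.char g := by
  rcases kl_sp_d4_cases g with rfl | rfl | rfl | rfl | rfl | rfl | rfl | rfl <;>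
  simp only [DihedralGroup.inv_r, DihedralGroup.inv_sr, neg_zero] <;>
  reduce_mod_char <;>
  cases χ <;>
  simp only [D4Irrep.char, val1, val3, ne10, ne12, ne30, ne32, if_false] <;>
  norm_num

/-- The characters of `D₄` are class functions: `χ(x y) = χ(y x)`. [folklore] -/
theorem kl_sp_char_comm (χ : D4Irrep) (x y : DihedralGroup 4) : χ.char (x * y) = χ.char (y * x) := by
  rcases kl_sp_d4_cases x with rfl | rfl | rfl | rfl | rfl | rfl | rfl | rfl <;>
  rcases kl_sp_d4_cases y with rfl | rfl | rfl | rfl | rfl | rfl | rfl | rfl <;>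
  simp only [DihedralGroup.r_mul_r, DihedralGroup.r_mul_sr, DihedralGroup.sr_mul_r,
    DihedralGroup.sr_mul_sr] <;>
  (try reduce_mod_char) <;>
  cases χ <;>
  simp only [D4Irrep.char, val0, val1, val2, val3, ne10, ne12, ne30, ne32, if_false] <;>
  norm_num

/-- **Character convolution** on `D₄`: `∑_g χ(g) χ(p g⁻¹) = (8 / dim χ) χ(p)` for every irrep `χ`
and every `p` (the central idempotent `e_χ = (dim χ/8) ∑ χ(g) g` squares to itself). [folklore] -/
theorem kl_sp_char_conv (χ : D4Irrep) (p : DihedralGroup 4) :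
    ∑ g, χ.char g * χ.char (p * g⁻¹) = (8 / χ.dim : ℝ) * χ.char p := by
  rw [kl_sp_sum_d4]
  simp only [DihedralGroup.inv_r, DihedralGroup.inv_sr, neg_zero]
  rcases kl_sp_d4_cases p with rfl | rfl | rfl | rfl | rfl | rfl | rfl | rfl <;>
  simp only [DihedralGroup.r_mul_r, DihedralGroup.r_mul_sr, DihedralGroup.sr_mul_r,
    DihedralGroup.sr_mul_sr] <;>
  reduce_mod_char <;>
  cases χ <;>
  simp only [D4Irrep.char, D4Irrep.dim, val0, val1, val2, val3, ne10, ne12, ne20, ne30, ne32,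
    if_true, if_false] <;>
  norm_num

/-- `dim χ ≠ 0`. [folklore] -/
theorem kl_sp_dim_ne_zero (χ : D4Irrep) : (χ.dim : ℝ) ≠ 0 := by
  cases χ <;> simp [D4Irrep.dim]

/-! ### Group algebra: the isotypic idempotent of an anti-multiplicative family -/

/-- In any `ℝ`-algebra, for an anti-multiplicative family `V g V h = V (h g)` indexed by `D₄`, the
element `(dim χ/8) ∑_g χ(g) V g` is idempotent. [folklore] -/
theorem kl_sp_proj_mul_proj {A : Type*} [Ring A] [Algebra ℝ A] (V : DihedralGroup 4 → A)
    (hV : ∀ g h, V g * V h = V (h * g)) (χ : D4Irrep) :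
    ((χ.dim / 8 : ℝ) • ∑ g, χ.char g • V g) * ((χ.dim / 8 : ℝ) • ∑ g, χ.char g • V g) =
      (χ.dim / 8 : ℝ) • ∑ g, χ.char g • V g := by
  rw [smul_mul_smul_comm, Finset.sum_mul_sum]
  simp_rw [smul_mul_smul_comm, hV]
  have hre : ∀ g : DihedralGroup 4, ∑ h, (χ.char g * χ.char h) • V (h * g) =
      ∑ p, (χ.char g * χ.char (p * g⁻¹)) • V p := fun g =>
    Fintype.sum_equiv (Equiv.mulRight g) _ _ fun h => by simp
  simp_rw [hre]
  rw [Finset.sum_comm]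
  simp_rw [← Finset.sum_smul, kl_sp_char_conv]
  rw [Finset.smul_sum, Finset.smul_sum]
  refine Finset.sum_congr rfl fun p _ => ?_
  rw [smul_smul, smul_smul]
  congr 1
  have := kl_sp_dim_ne_zero χ
  field_simp

/-- In any `ℝ`-algebra, for an anti-multiplicative family `V g V h = V (h g)` indexed by `D₄`, the
element `(dim χ/8) ∑_h χ(h) V h` commutes with every `V g` (class-function property). [folklore] -/
theorem kl_sp_comm_proj {A : Type*} [Ring A] [Algebra ℝ A] (V : DihedralGroup 4 → A)
    (hV : ∀ g h, V g * V h = V (h * g)) (χ : D4Irrep) (g : DihedralGroup 4) :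
    V g * ((χ.dim / 8 : ℝ) • ∑ h, χ.char h • V h) =
      ((χ.dim / 8 : ℝ) • ∑ h, χ.char h • V h) * V g := by
  rw [mul_smul_comm, smul_mul_assoc, Finset.mul_sum, Finset.sum_mul]
  congr 1
  simp_rw [mul_smul_comm, smul_mul_assoc, hV]
  rw [Fintype.sum_equiv (Equiv.mulRight g) (fun h => χ.char h • V (h * g))
      (fun p => χ.char (p * g⁻¹) • V p) (fun h => by simp),
    Fintype.sum_equiv (Equiv.mulLeft g) (fun h => χ.char h • V (g * h))
      (fun p => χ.char (g⁻¹ * p) • V p) (fun h => by simp)]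
  exact Finset.sum_congr rfl fun p _ => by rw [kl_sp_char_comm χ p g⁻¹]

/-! ### The pointwise projector `d4Project` -/

/-- `d4Momentum` is a left action: `γ • (δ • k) = (γ δ) • k` (the 64 pairs, normalised with
`rot ∘ refl = refl ∘ rot³`, `rot⁴ = id`, `refl² = id`). [folklore] -/
theorem kl_sp_d4_mul (g h : DihedralGroup 4) (k : Momentum) :
    d4Momentum g (d4Momentum h k) = d4Momentum (g * h) k := by
  have rot_refl : ∀ q : Momentum,
      rotMomentum (reflMomentum q) = reflMomentum (rotMomentum (rotMomentum (rotMomentum q))) :=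
    fun q => by ext i; fin_cases i <;> simp
  rcases kl_sp_d4_cases g with rfl | rfl | rfl | rfl | rfl | rfl | rfl | rfl <;>
  rcases kl_sp_d4_cases h with rfl | rfl | rfl | rfl | rfl | rfl | rfl | rfl <;>
  simp only [DihedralGroup.r_mul_r, DihedralGroup.r_mul_sr, DihedralGroup.sr_mul_r,
    DihedralGroup.sr_mul_sr] <;>
  (try reduce_mod_char) <;>
  simp only [d4_r0, d4_r1, d4_r2, d4_r3, d4_sr0, d4_sr1, d4_sr2, d4_sr3, rot_refl,
    kl_d4_rot_rot_rot_rot, kl_d4_refl_refl]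

/-- The composition maps `ψ ↦ ψ ∘ γ` form an anti-multiplicative family of endomorphisms of
`Momentum → ℝ`. [folklore] -/
theorem kl_sp_funLeft_mul (g h : DihedralGroup 4) :
    LinearMap.funLeft ℝ ℝ (d4Momentum g) * LinearMap.funLeft ℝ ℝ (d4Momentum h) =
      LinearMap.funLeft ℝ ℝ (d4Momentum (h * g)) := by
  rw [show d4Momentum (h * g) = d4Momentum h ∘ d4Momentum g from
    funext fun k => (kl_sp_d4_mul h g k).symm, LinearMap.funLeft_comp]
  rfl

/-- `d4Project χ` is the value of the group-algebra element `(dim χ/8) ∑_γ χ(γ) (· ∘ γ)`. [folklore] -/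
theorem kl_sp_d4Project_eq_end (χ : D4Irrep) (ψ : Momentum → ℝ) :
    d4Project χ ψ = ((χ.dim / 8 : ℝ) • ∑ γ : DihedralGroup 4,
      χ.char γ • LinearMap.funLeft ℝ ℝ (d4Momentum γ)) ψ := by
  funext k
  simp only [LinearMap.smul_apply, LinearMap.coe_sum, Finset.sum_apply, LinearMap.funLeft_apply,
    Pi.smul_apply, smul_eq_mul, d4Project]

/-- **Pointwise idempotency of the isotypic projector**: `d4Project χ ψ` lies in the channel `χ`
for every function `ψ`. [folklore] -/
theorem kl_sp_inChannel_d4Project (χ : D4Irrep) (ψ : Momentum → ℝ) :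
    InChannel χ (d4Project χ ψ) := by
  show d4Project χ (d4Project χ ψ) = d4Project χ ψ
  rw [kl_sp_d4Project_eq_end χ (d4Project χ ψ), kl_sp_d4Project_eq_end χ ψ, ← Module.End.mul_apply,
    kl_sp_proj_mul_proj _ kl_sp_funLeft_mul χ]

/-! ### The operators on `L²(σ)` -/

/-- The a.e. action of `P_χ = (dim χ/8) ∑_g χ(g) U g` (for any measure `σ` on momentum space and any
family `U` acting a.e. by composition): it is the pointwise projector `d4Project χ`. [folklore] -/
theorem kl_sp_ae_formula {σ : Measure Momentum} (U : DihedralGroup 4 → (Lp ℝ 2 σ →L[ℝ] Lp ℝ 2 σ))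
    (hU : ∀ (g : DihedralGroup 4) (φ : Lp ℝ 2 σ),
      (U g φ : Momentum → ℝ) =ᵐ[σ] fun k => φ (d4Momentum g k))
    (χ : D4Irrep) (φ : Lp ℝ 2 σ) :
    ((((χ.dim / 8 : ℝ) • ∑ g : DihedralGroup 4, χ.char g • U g) φ : Lp ℝ 2 σ) : Momentum → ℝ)
      =ᵐ[σ] fun k => d4Project χ φ k := by
  have h3 : ∀ᵐ k ∂σ, ∀ g : DihedralGroup 4,
      ((χ.char g • U g φ : Lp ℝ 2 σ) : Momentum → ℝ) k = χ.char g * φ (d4Momentum g k) :=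
    ae_all_iff.2 fun g => by
      filter_upwards [Lp.coeFn_smul (χ.char g) (U g φ), hU g φ] with k hk1 hk2
      rw [hk1, Pi.smul_apply, hk2, smul_eq_mul]
  rw [smul_apply, sum_apply]
  simp_rw [smul_apply]
  filter_upwards [Lp.coeFn_smul ((χ.dim / 8 : ℝ)) (∑ g, χ.char g • U g φ),
    Lp.coeFn_fun_finsetSum Finset.univ (fun g => χ.char g • U g φ), h3] with k hk1 hk2 hk3
  rw [hk1, Pi.smul_apply, hk2, smul_eq_mul, d4Project]
  congr 1
  exact Finset.sum_congr rfl fun g _ => hk3 g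

/-- If `σ` is invariant under the action of `D₄`, the pointwise projection `d4Project χ φ` of (the
canonical representative of) an `L²(σ)` class is square integrable. [folklore] -/
theorem kl_sp_memLp_d4Project {σ : Measure Momentum}
    (hmp : ∀ γ : DihedralGroup 4, MeasurePreserving (d4Momentum γ) σ σ) (χ : D4Irrep) (φ : Lp ℝ 2 σ) :
    MemLp (d4Project χ φ) 2 σ := by
  have h1 : ∀ γ : DihedralGroup 4, MemLp (fun k => χ.char γ * φ (d4Momentum γ k)) 2 σ :=
    fun γ => ((Lp.memLp φ).comp_measurePreserving (hmp γ)).const_mul (χ.char γ)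
  exact (memLp_finsetSum Finset.univ fun γ _ => h1 γ).const_mul (χ.dim / 8 : ℝ)

/-- If `σ` is invariant under the action of `D₄` and `U` acts a.e. by composition, then `P_χ` fixes the
class of every square-integrable function lying (pointwise) in the channel `χ`. [folklore] -/
theorem kl_sp_proj_toLp {σ : Measure Momentum}
    (hmp : ∀ γ : DihedralGroup 4, MeasurePreserving (d4Momentum γ) σ σ)
    (U : DihedralGroup 4 → (Lp ℝ 2 σ →L[ℝ] Lp ℝ 2 σ))
    (hU : ∀ (g : DihedralGroup 4) (φ : Lp ℝ 2 σ),
      (U g φ : Momentum → ℝ) =ᵐ[σ] fun k => φ (d4Momentum g k))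
    (χ : D4Irrep) (ψ : Momentum → ℝ) (hψ : MemLp ψ 2 σ) (hch : InChannel χ ψ) :
    ((χ.dim / 8 : ℝ) • ∑ g : DihedralGroup 4, χ.char g • U g) (hψ.toLp ψ) = hψ.toLp ψ := by
  apply Lp.ext
  have h1 := kl_sp_ae_formula U hU χ (hψ.toLp ψ)
  have h2 : ∀ᵐ k ∂σ, ∀ γ : DihedralGroup 4,
      (hψ.toLp ψ : Momentum → ℝ) (d4Momentum γ k) = ψ (d4Momentum γ k) :=
    ae_all_iff.2 fun γ => (hmp γ).quasiMeasurePreserving.ae_eq_comp hψ.coeFn_toLp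
  filter_upwards [h1, h2, hψ.coeFn_toLp] with k hk1 hk2 hk3
  rw [hk1, hk3]
  calc d4Project χ (hψ.toLp ψ) k = d4Project χ ψ k := by simp only [d4Project, hk2]
    _ = ψ k := congrFun hch k

/-- **Stub `stub_klSectorProj`: isotypic projections on `L²(σ_μ)`.** Given composition operators `U_g`
(a.e. `φ ∘ g`, `U_1 = 1`, `U_g U_h = U_{hg}`, `U_g* = U_{g⁻¹}`), for every irrep `χ` of `D₄` the
operator `P_χ = (dim χ/8) ∑_g χ(g) U_g` acts a.e. as `d4Project χ`, is an orthogonal projection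
commuting with every `U_g` (central idempotent of the group algebra; real characters, `g ∼ g⁻¹`), its
range is exactly the classes of square-integrable functions in the channel `χ`, and
`P_E = (1 - U_{r²})/2` (odd part). [folklore] -/
theorem stub_klSectorProj : ∀ μ ∈ Set.Ioo (-4 : ℝ) 0,
    ∀ U : DihedralGroup 4 →
        (Lp ℝ 2 (fermiCurveMeasure (squareDispersion 1 0) μ) →L[ℝ] Lp ℝ 2 (fermiCurveMeasure (squareDispersion 1 0) μ)),
      (∀ (g : DihedralGroup 4) (φ : Lp ℝ 2 (fermiCurveMeasure (squareDispersion 1 0) μ)),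
        (U g φ : Momentum → ℝ) =ᵐ[fermiCurveMeasure (squareDispersion 1 0) μ] fun k => φ (d4Momentum g k)) →
      U 1 = 1 → (∀ g h : DihedralGroup 4, U g * U h = U (h * g)) →
      (∀ (g : DihedralGroup 4) (φ ψ : Lp ℝ 2 (fermiCurveMeasure (squareDispersion 1 0) μ)),
        inner ℝ (U g φ) ψ = inner ℝ φ (U g⁻¹ ψ)) →
      ∀ χ : D4Irrep,
        ∃ P : Lp ℝ 2 (fermiCurveMeasure (squareDispersion 1 0) μ) →L[ℝ] Lp ℝ 2 (fermiCurveMeasure (squareDispersion 1 0) μ),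
          P = (χ.dim / 8 : ℝ) • ∑ g : DihedralGroup 4, χ.char g • U g ∧
          (∀ φ : Lp ℝ 2 (fermiCurveMeasure (squareDispersion 1 0) μ),
            (P φ : Momentum → ℝ) =ᵐ[fermiCurveMeasure (squareDispersion 1 0) μ] fun k => d4Project χ φ k) ∧
          P * P = P ∧ IsSelfAdjoint P ∧
          (∀ g : DihedralGroup 4, U g * P = P * U g) ∧
          (∀ (ψ : Momentum → ℝ) (hψ : MemLp ψ 2 (fermiCurveMeasure (squareDispersion 1 0) μ)),
            InChannel χ ψ → P (hψ.toLp ψ) = hψ.toLp ψ) ∧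
          (∀ φ : Lp ℝ 2 (fermiCurveMeasure (squareDispersion 1 0) μ), P φ = φ →
            ∃ ψ : Momentum → ℝ, InChannel χ ψ ∧ MemLp ψ 2 (fermiCurveMeasure (squareDispersion 1 0) μ) ∧
              (φ : Momentum → ℝ) =ᵐ[fermiCurveMeasure (squareDispersion 1 0) μ] ψ) ∧
          (χ = D4Irrep.E → P = (1 / 2 : ℝ) • (1 - U (DihedralGroup.r 2))) := by
  intro μ hμ U hU hU1 hUmul hUadj χ
  have hmp := stub_klD4Invariant stub_klGradient μ hμ
  refine ⟨(χ.dim / 8 : ℝ) • ∑ g : DihedralGroup 4, χ.char g • U g, rfl, kl_sp_ae_formula U hU χ,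
    kl_sp_proj_mul_proj U hUmul χ, ?_, fun g => kl_sp_comm_proj U hUmul χ g,
    kl_sp_proj_toLp hmp U hU χ, ?_, ?_⟩
  · -- self-adjointness: `U_g* = U_{g⁻¹}`, reindex `g ↦ g⁻¹`, `χ(g⁻¹) = χ(g)`
    rw [ContinuousLinearMap.isSelfAdjoint_iff_isSymmetric]
    intro x y
    simp only [ContinuousLinearMap.coe_coe, smul_apply, sum_apply, real_inner_smul_left,
      real_inner_smul_right, sum_inner, inner_sum]
    congr 1
    simp_rw [hUadj]
    exact Fintype.sum_equiv (Equiv.inv _) _ _ fun g => by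
      simp only [Equiv.inv_apply, kl_sp_char_inv]
  · -- fixed points have channel representatives
    intro φ hφ
    refine ⟨d4Project χ φ, kl_sp_inChannel_d4Project χ φ, kl_sp_memLp_d4Project hmp χ φ, ?_⟩
    have h1 := kl_sp_ae_formula U hU χ φ
    rw [hφ] at h1
    exact h1
  · -- the `E` projector is the odd part
    intro hχ
    subst hχ
    rw [kl_sp_sum_d4]
    simp only [D4Irrep.char, D4Irrep.dim, ne10, ne12, ne20, ne30, ne32, if_true, if_false, zero_smul,
      add_zero, DihedralGroup.r_zero, hU1, Nat.cast_ofNat]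
    module

end Summit.HubbardSuperconductivity.HubbardSuperconductivity.Theorems

end
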